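import Mathlib
import HarnessLib
import Summits.ABC.ABC.Theses.RibetTakahashiSplit

/-!
# Sketch — crux-ideate stmt-ABC-1561 (ManyPrimeValuationProduct), round 1, ideator 1

First-lemma signatures for the idea cards `weighted-szpiro-bootstrap` and `jl-zero-cycle-height`.
All declarations are `Prop`-valued statements over existing declarations (no proofs, no sorry).
-/

namespace Summit.ABC.ABC.Cruxes.ManyPrimeValuationProduct.Ideas

open scoped BigOperators Classical
open Summit.ABC.ABC.Theses.RibetTakahashiSplit

/-- The geometric Tamagawa product `T(E) = ∏_{p ∥ N} ord_p(Δ_min)` exactly as inlined in the route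
file (product over prime factors `p` of the conductor with `p² ∤ N`). -/
noncomputable def valProd (W : WeierstrassCurve ℚ) : ℕ :=
  ∏ p ∈ (W.conductorNorm ℤ).primeFactors with ¬ p ^ 2 ∣ W.conductorNorm ℤ,
    (W.minimalDiscriminantNorm ℤ).factorization p

/-- CARD weighted-szpiro-bootstrap, lemma B0 (trivial entropy bound, provable now):
`T(E) ≤ C_η · N^η · |Δ_min|^{1/12}` for every `η > 0` — from `n ≤ (12/(e log 2)) · p^{n/12}` and
`ω(N) ≤ η' log N + O(1)`. -/
def TrivialEntropyBound : Prop :=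
  ∀ η : ℝ, 0 < η → ∃ C : ℝ, ∀ (W : WeierstrassCurve ℚ) [W.IsElliptic],
    (valProd W : ℝ) ≤ C * (W.conductorNorm ℤ : ℝ) ^ η *
      ((W.minimalDiscriminantNorm ℤ : ℕ) : ℝ) ^ (1 / 12 : ℝ)

/-- CARD weighted-szpiro-bootstrap, lemma B1 (entropy from energy, provable now): any POLYNOMIAL
Szpiro bound `|Δ_min| ≤ K · N^β` (β arbitrary but fixed) gives `T(E) ≤ C_ε N^ε`, by
`∑ log n_p ≤ ω · log((β log N + log K)/(ω log 2))` and `ω(N) = o(log N)`. -/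
def EntropyFromEnergy : Prop :=
  ∀ β K : ℝ, ∀ ε : ℝ, 0 < ε → ∃ C : ℝ, ∀ (W : WeierstrassCurve ℚ) [W.IsElliptic],
    ((W.minimalDiscriminantNorm ℤ : ℕ) : ℝ) ≤ K * (W.conductorNorm ℤ : ℝ) ^ β →
      (valProd W : ℝ) ≤ C * (W.conductorNorm ℤ : ℝ) ^ ε

/-- CARD weighted-szpiro-bootstrap, lemma B2 (the bootstrap, provable now from B0):
`WeightedSzpiroBound` (crux r3′ of the route) alone implies POLYNOMIAL Szpiro for global minimal
models semistable away from 2: feeding `T ≤ C_η N^η |Δ|^{1/12}` into `|Δ| ≤ C (N·T)^{7}` gives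
`|Δ|^{5/12} ≤ C' N^{7(1+η)}`, i.e. `|Δ| ≤ C'' N^{84(1+η)/5}`. -/
def PolySzpiroOfWeighted : Prop :=
  WeightedSzpiroBound → ∃ β C : ℝ, ∀ W₀ : WeierstrassCurve ℤ, (W₀.baseChange ℚ).IsElliptic →
    (∀ v : IsDedekindDomain.HeightOneSpectrum ℤ, (W₀.baseChange ℚ).IsMinimalAt v) →
    (∀ p : ℕ, p.Prime → p ≠ 2 → ¬ p ^ 2 ∣ (W₀.baseChange ℚ).conductorNorm ℤ) →
      ((|W₀.Δ| : ℤ) : ℝ) ≤ C * (((W₀.baseChange ℚ).conductorNorm ℤ : ℕ) : ℝ) ^ β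

/-- CARD weighted-szpiro-bootstrap, FIRST LEMMA (the structural claim; provable now from B0–B2 +
existence of global minimal models `hasGlobalMinimalModel_rat`): the rank-3 crux r3′ implies BOTH
valuation-product cruxes r2 and r4 of route-ABC-RibetTakahashiSplit. -/
def Bootstrap : Prop :=
  WeightedSzpiroBound → ManyPrimeValuationProduct ∧ FewPrimeValuationProduct

/-- CARD weighted-szpiro-bootstrap, Transfer remark (energy threshold, provable now): an energy
bound with a POLY-LOG-LOG loss, `log |Δ_min| ≤ K · log N · (log log N)^A`, already implies the crux
(AM–GM + `ω(N) ≤ (1+o(1)) log N / log log N`). -/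
def PolyloglogEnergyImpliesCrux : Prop :=
  (∃ A K : ℝ, ∀ (W : WeierstrassCurve ℚ) [W.IsElliptic],
      (∀ p : ℕ, p.Prime → p ≠ 2 → ¬ p ^ 2 ∣ W.conductorNorm ℤ) →
      Real.log ((W.minimalDiscriminantNorm ℤ : ℕ) : ℝ) ≤
        K * Real.log (W.conductorNorm ℤ : ℝ) *
          (Real.log (Real.log (W.conductorNorm ℤ : ℝ))) ^ A + K) →
    ManyPrimeValuationProduct

/-- CARD jl-zero-cycle-height: the M-FREE per-factorisation bound with exponent `θ` — the typed
arithmetic shadow of a Petersson lower bound `‖f_D^{int}‖² ≥ N^{1-θ-ε}` for the integral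
Jacquet–Langlands eigenform on `X_0^D(M)` (Pasten Thm 6.1(b) + §16 identity + GHL), stated for every
set `D` of an even number (≥ 2) of primes of multiplicative reduction of a curve semistable away
from 2.  The card's line claims `FactorisationBound 0` via the Arakelov adjunction identity for the
section `f_D^{int}` (zero-cycle height + vertical vanishing − modular height). -/
def FactorisationBound (θ : ℝ) : Prop :=
  ∀ ε : ℝ, 0 < ε → ∃ C : ℝ, ∀ (W : WeierstrassCurve ℚ) [W.IsElliptic],
    (∀ p : ℕ, p.Prime → p ≠ 2 → ¬ p ^ 2 ∣ W.conductorNorm ℤ) →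
    ∀ D : Finset ℕ, D ⊆ ((W.conductorNorm ℤ).primeFactors.filter
        (fun p => ¬ p ^ 2 ∣ W.conductorNorm ℤ)) → Even D.card → 2 ≤ D.card →
      ((∏ p ∈ D, (W.minimalDiscriminantNorm ℤ).factorization p : ℕ) : ℝ) ≤
        C * (W.conductorNorm ℤ : ℝ) ^ (θ + ε)

/-- CARD jl-zero-cycle-height, FIRST LEMMA (provable now, elementary covering): with ≥ 4 odd
multiplicative primes every multiplicative prime lies in an admissible even set and
`T ≤ T_{D₁} · T_{D₂}`; so the exponent-0 factorisation bound gives the crux. -/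
def FactorisationGlue : Prop :=
  FactorisationBound 0 → ManyPrimeValuationProduct

/-- The θ-ladder packaged the same way (route header: EigenLowerBound(θ) ⟹ T ≤ N^{2θ+ε} with two
covering sets): any `θ` gives a valuation-product bound with exponent `2θ`. -/
def FactorisationLadder : Prop :=
  ∀ θ : ℝ, 0 ≤ θ → FactorisationBound θ →
    ∀ ε : ℝ, 0 < ε → ∃ C : ℝ, ∀ (W : WeierstrassCurve ℚ) [W.IsElliptic],
      (∀ p : ℕ, p.Prime → p ≠ 2 → ¬ p ^ 2 ∣ W.conductorNorm ℤ) →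
      4 ≤ ((W.conductorNorm ℤ).primeFactors.filter
        (fun p => p ≠ 2 ∧ ¬ p ^ 2 ∣ W.conductorNorm ℤ)).card →
        (valProd W : ℝ) ≤ C * (W.conductorNorm ℤ : ℝ) ^ (2 * θ + ε)

end Summit.ABC.ABC.Cruxes.ManyPrimeValuationProduct.Ideas
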